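import Summits.ResolutionOfSingularities.ResolutionOfSingularities.Theorems.FrobeniusLadderFRationalResolutionFixedPointCompletionChart
import HarnessLib

/-!
# Crux `FrobeniusLadder.FRationalResolution` (stmt-ResolutionOfSingularities-15317), line `redirect`,
# stub `stub_diagonalizableQuotientResolution` — `κ(𝔮)⟦P_a⟧ ≅ ((S₀)_𝔮)^` at a fixed point, for a GIVEN homogeneous
# regular system of parameters (parameter-INPUT form of `…FixedPointCompletionChart`, p840792)

`…FixedPointCompletionChart.exists_ringEquiv_monoidPowerSeries_adicCompletion_of_fixed` PRODUCES homogeneous parameters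
`x₁,…,x_n` of a fixed prime `𝔔` and their degrees `aᵢ` existentially, so a consumer cannot identify the weight kernel `P_a`.
Here the consumer SUPPLIES them: homogeneous `xᵢ ∈ 𝔔 ∩ S_{aᵢ}` whose images generate `𝔪_{S_𝔔}`, with `n = dim S_𝔔` (a
homogeneous regular system of parameters — e.g. the coordinates `y₁,…,y_n`, all of degree `1 ∈ ℤ/r`, at the origin of
`𝔸ⁿ` with the `μ_r`-action of type `1/r(1,…,1)`), and any `P` with `m ∈ P ↔ Σ mᵢ • aᵢ = 0`:

* ★★ `chartData_of_parameters` — d = 0 Kato chart data on any localization `Rq` of `S₀` at `𝔮 = 𝔔 ∩ S₀` by `P`: the monomial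
  chart `χ(m) = x^m ∈ S₀`, `χ(P ∖ 0) ⊆ 𝔪_{Rq}` generating `𝔪_{Rq}`, `P` finitely generated, `dim Rq = rank P = n`
  (`S` Noetherian of finite type over a field, torsion grading; regularity of `S` is implied by the input and not assumed).
* ★★★ `exists_ringEquiv_monoidPowerSeries_adicCompletion_of_parameters` — **`κ(𝔮)⟦P⟧ ≃+* Rq^`, `x^m ↦ x^m`.**

Honest label: helper theorems toward ONE leaf stub (no stub, crux or summit closed). No definitions, no named facts, no sorry.
[cite: Kato1994, Thm. (3.2)] [cite: Matsumura1987, Thm. 28.3 (ii); Thm. 15.1] [folklore; cite: SGA3, Exp. VIII §4–5]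
-/

noncomputable section

-- single-problem summit: the doubled namespace component is forced
set_option linter.dupNamespace false

open IsLocalRing
open Literature.RingTheory.MvPowerSeries Literature.RingTheory.MvPowerSeries.monoidPowerSeries
open Literature.AlgebraicGeometry.Resolution
open Literature.AlgebraicGeometry.Resolution.DiagonalizableQuotient

namespace Summit.ResolutionOfSingularities.ResolutionOfSingularities.Theorems.FRationalResolution.FixedPointCompletionChart

universe u w

variable {k : Type u} [Field k] {A : Type w} [DecidableEq A] [AddCommGroup A] {S : Type u}
  [CommRing S] [Algebra k S] (𝒮 : A → Submodule k S) [GradedAlgebra 𝒮]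

omit [DecidableEq A] in
/-- A submonoid described by the weight equation IS the weight kernel. [folklore] -/
theorem eq_mker_weight_of_iff {n : ℕ} (a : Fin n → A) (P : AddSubmonoid (Fin n →₀ ℕ))
    (hP : ∀ m, m ∈ P ↔ Finsupp.weight a m = 0) :
    P = AddMonoidHom.mker (Finsupp.weight a : (Fin n →₀ ℕ) →+ A) :=
  AddSubmonoid.ext fun m => (hP m).trans AddMonoidHom.mem_mker.symm

/-- ★★ **d = 0 Kato chart data at a fixed point, for given homogeneous parameters.** `S` of finite type over a field,
graded by a torsion group `A`; `𝔔` a prime containing every `S_a`, `a ≠ 0`; homogeneous `xᵢ ∈ 𝔔 ∩ S_{aᵢ}` (`i < n`)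
generating `𝔪_{S_𝔔}` with `n = dim S_𝔔`; `P = {m : Σ mᵢ • aᵢ = 0}`; `Rq` any localization of `S₀` at `𝔮 = 𝔔 ∩ S₀`. Then
`P` is finitely generated of rank `n = dim Rq`, and the monomial chart `χ(m) = x^m ∈ S₀` (`χ 0 = 1`, multiplicative on `P`)
has `χ(P ∖ 0) ⊆ 𝔪_{Rq}` generating `𝔪_{Rq}`. [cite: Kato1994, Def. (2.1), Thm. (3.2)] [folklore; cite: SGA3, Exp. VIII §4–5] -/
theorem chartData_of_parameters [Algebra.FiniteType k S]
    (hA : AddMonoid.IsTorsion A) (𝔔 : Ideal S) [𝔔.IsPrime]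
    (hfix : ∀ a : A, a ≠ 0 → ∀ s ∈ 𝒮 a, s ∈ 𝔔)
    {n : ℕ} (x : Fin n → S) (a : Fin n → A) (hxa : ∀ i, x i ∈ 𝔔 ∧ x i ∈ 𝒮 (a i))
    (hspan : Ideal.span (algebraMap S (Localization.AtPrime 𝔔) '' Set.range x) =
      maximalIdeal (Localization.AtPrime 𝔔))
    (hn : (n : WithBot ℕ∞) = ringKrullDim (Localization.AtPrime 𝔔))
    (P : AddSubmonoid (Fin n →₀ ℕ)) (hP : ∀ m, m ∈ P ↔ Finsupp.weight a m = 0)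
    (Rq : Type u) [CommRing Rq] [Algebra (𝒮 0) Rq]
    [IsLocalization.AtPrime Rq (𝔔.comap (algebraMap (𝒮 0) S))] [IsLocalRing Rq] :
    P.FG ∧ rank P = n ∧ ringKrullDim Rq = n ∧
    ∃ χ : (Fin n →₀ ℕ) → 𝒮 0,
      (∀ m ∈ P, ((χ m : 𝒮 0) : S) = ∏ i, x i ^ m i) ∧ χ 0 = 1 ∧
      (∀ m ∈ P, ∀ m' ∈ P, χ (m + m') = χ m * χ m') ∧
      (∀ m ∈ P, m ≠ 0 → algebraMap (𝒮 0) Rq (χ m) ∈ maximalIdeal Rq) ∧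
      maximalIdeal Rq ≤ Ideal.span ((fun m => algebraMap (𝒮 0) Rq (χ m)) '' {m | m ∈ P ∧ m ≠ 0}) := by
  classical
  haveI : IsNoetherianRing S := Algebra.FiniteType.isNoetherianRing k S
  have hx𝔔 : ∀ i, x i ∈ 𝔔 := fun i => (hxa i).1
  have ha : ∀ i, x i ∈ 𝒮 (a i) := fun i => (hxa i).2
  have htors : ∀ i, IsOfFinAddOrder (a i) := fun i => hA (a i)
  have hPeq := eq_mker_weight_of_iff a P hP
  -- the parameters as a finite set of homogeneous elements
  set t : Finset S := Finset.univ.image x with ht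
  have hrange : (↑t : Set S) = Set.range x := by
    rw [ht, Finset.coe_image, Finset.coe_univ, Set.image_univ]
  have hthom : ∀ s ∈ t, SetLike.IsHomogeneousElem 𝒮 s := by
    intro s hs
    rw [ht, Finset.mem_image] at hs
    obtain ⟨i, -, rfl⟩ := hs
    exact ⟨a i, ha i⟩
  have htspan : Ideal.span (algebraMap S (Localization.AtPrime 𝔔) '' (↑t : Set S)) =
      maximalIdeal (Localization.AtPrime 𝔔) := by
    rw [hrange, hspan]
  -- the monomial chart
  have hmem0 : ∀ m ∈ P, ∏ i, x i ^ m i ∈ 𝒮 0 := fun m hm => by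
    have h := prod_pow_mem_weight 𝒮 x a ha m
    rwa [(hP m).mp hm] at h
  let χ : (Fin n →₀ ℕ) → 𝒮 0 := fun m => if hm : m ∈ P then ⟨∏ i, x i ^ m i, hmem0 m hm⟩ else 1
  have hχ : ∀ m (hm : m ∈ P), χ m = ⟨∏ i, x i ^ m i, hmem0 m hm⟩ := fun m hm => dif_pos hm
  set 𝔮 : Ideal (𝒮 0) := 𝔔.comap (algebraMap (𝒮 0) S) with h𝔮
  have hχ𝔮 : ∀ m ∈ P, m ≠ 0 → χ m ∈ 𝔮 := by
    intro m hm hm0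
    obtain ⟨i, hi⟩ : ∃ i, m i ≠ 0 := by
      by_contra h
      push Not at h
      exact hm0 (Finsupp.ext h)
    change ((χ m : 𝒮 0) : S) ∈ 𝔔
    rw [hχ m hm]
    change ∏ i, x i ^ m i ∈ 𝔔
    rw [← Finset.mul_prod_erase Finset.univ _ (Finset.mem_univ i)]
    exact Ideal.mul_mem_right _ _ (Ideal.pow_mem_of_mem 𝔔 (hx𝔔 i) _ (Nat.pos_of_ne_zero hi))
  -- `dim Rq = dim S_𝔔 = n` (brick `…FixedPointDimension`)
  have hdim : ringKrullDim Rq = n := by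
    have hle : 𝔮.primeCompl ≤ 𝔔.primeCompl.comap (algebraMap (𝒮 0) S) := fun r hr => hr
    letI : Algebra Rq (Localization.AtPrime 𝔔) :=
      (IsLocalization.map (Localization.AtPrime 𝔔) (algebraMap (𝒮 0) S) hle : Rq →+* _).toAlgebra
    haveI : IsScalarTower (𝒮 0) Rq (Localization.AtPrime 𝔔) :=
      IsScalarTower.of_algebraMap_eq fun r => by
        rw [RingHom.algebraMap_toAlgebra, IsLocalization.map_eq,
          IsScalarTower.algebraMap_apply (𝒮 0) S (Localization.AtPrime 𝔔)]
    rw [FixedPointDimension.ringKrullDim_atPrime_eq_of_fixed 𝒮 hA 𝔔 hfix Rq (Localization.AtPrime 𝔔), ← hn]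
  refine ⟨hPeq ▸ mker_weight_fg a htors, hPeq ▸ rank_mker_weight a htors, hdim, χ,
    fun m hm => by rw [hχ m hm], ?_, ?_, ?_, ?_⟩
  · -- `χ 0 = 1`
    rw [hχ 0 (zero_mem P)]
    exact Subtype.ext (by simp)
  · -- multiplicativity on `P`
    intro m hm m' hm'
    rw [hχ m hm, hχ m' hm', hχ (m + m') (add_mem hm hm')]
    refine Subtype.ext ?_
    change ∏ i, x i ^ (m + m') i = (∏ i, x i ^ m i) * ∏ i, x i ^ m' i
    rw [← Finset.prod_mul_distrib]
    exact Finset.prod_congr rfl fun i _ => by rw [Finsupp.add_apply, pow_add]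
  · -- `χ(P ∖ 0) ⊆ 𝔪_{Rq}`
    intro m hm hm0
    have h := Ideal.mem_map_of_mem (algebraMap (𝒮 0) Rq) (hχ𝔮 m hm hm0)
    rwa [IsLocalization.AtPrime.map_eq_maximalIdeal 𝔮 Rq] at h
  · -- `𝔪_{Rq}` is generated by `χ(P ∖ 0)` (brick `…FixedPointKatoIdeal`)
    rw [FixedPointKatoIdeal.maximalIdeal_eq_span_monomials_of_fixed 𝒮 hA 𝔔 hfix t hthom htspan Rq]
    refine Ideal.span_le.mpr ?_
    rintro _ ⟨g, ⟨hg𝔔, hgcl⟩, rfl⟩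
    rw [hrange] at hgcl
    obtain ⟨e, he⟩ := Submonoid.mem_closure_range_iff_of_fintype.mp hgcl
    let m : Fin n →₀ ℕ := Finsupp.equivFunOnFinite.symm e
    have hprod : ∏ i, x i ^ m i = (g : S) := by
      rw [he]
      exact Finset.prod_congr rfl fun i _ => rfl
    by_cases hdeg : Finsupp.weight a m = 0
    · have hmP : m ∈ P := (hP m).mpr hdeg
      have hχm : χ m = g := by
        rw [hχ m hmP]
        exact Subtype.ext hprod
      have hm0 : m ≠ 0 := by
        rintro hm
        apply (inferInstance : 𝔔.IsPrime).ne_top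
        rw [Ideal.eq_top_iff_one]
        have h1 : (g : S) = 1 := by
          rw [← hprod, hm]
          simp
        rwa [h1] at hg𝔔
      exact Ideal.subset_span ⟨m, ⟨hmP, hm0⟩, by simp only [hχm]⟩
    · -- a monomial of non-zero degree lying in `S₀` vanishes
      have hgd : (g : S) ∈ 𝒮 (Finsupp.weight a m) := by
        rw [← hprod]
        exact prod_pow_mem_weight 𝒮 x a ha m
      have hg0 : (g : S) = 0 := by
        have h1 := DirectSum.decompose_of_mem_ne 𝒮 hgd hdeg
        rwa [DirectSum.decompose_of_mem_same 𝒮 g.2] at h1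
      have hg0' : g = 0 := Subtype.ext hg0
      rw [hg0', map_zero]
      exact Ideal.zero_mem _

/-- ★★★ **`κ(𝔮)⟦P⟧ ≅ ((S₀)_𝔮)^` at a fixed point, for given homogeneous parameters.** With the data of
`chartData_of_parameters` (homogeneous `xᵢ ∈ 𝔔 ∩ S_{aᵢ}` generating `𝔪_{S_𝔔}`, `n = dim S_𝔔`, `m ∈ P ↔ Σ mᵢ • aᵢ = 0`, `Rq` a
localization of `S₀` at `𝔮`): a ring isomorphism `κ(𝔮)⟦P⟧ ≃+* Rq^` sending `x^m ↦ x^m` (`κ(𝔮)` the residue field of `Rq`).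
[cite: Kato1994, Thm. (3.2)] [cite: Matsumura1987, Thm. 28.3 (ii)] [folklore; cite: SGA3, Exp. VIII §4–5] -/
theorem exists_ringEquiv_monoidPowerSeries_adicCompletion_of_parameters [Algebra.FiniteType k S]
    (hA : AddMonoid.IsTorsion A) (𝔔 : Ideal S) [𝔔.IsPrime]
    (hfix : ∀ a : A, a ≠ 0 → ∀ s ∈ 𝒮 a, s ∈ 𝔔)
    {n : ℕ} (x : Fin n → S) (a : Fin n → A) (hxa : ∀ i, x i ∈ 𝔔 ∧ x i ∈ 𝒮 (a i))
    (hspan : Ideal.span (algebraMap S (Localization.AtPrime 𝔔) '' Set.range x) =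
      maximalIdeal (Localization.AtPrime 𝔔))
    (hn : (n : WithBot ℕ∞) = ringKrullDim (Localization.AtPrime 𝔔))
    (P : AddSubmonoid (Fin n →₀ ℕ)) (hP : ∀ m, m ∈ P ↔ Finsupp.weight a m = 0)
    (Rq : Type u) [CommRing Rq] [Algebra (𝒮 0) Rq]
    [IsLocalization.AtPrime Rq (𝔔.comap (algebraMap (𝒮 0) S))] [IsLocalRing Rq] :
    ∃ (χ : (Fin n →₀ ℕ) → 𝒮 0) (e : ↥(monoidPowerSeries (ResidueField Rq) P) ≃+* AdicCompletion (maximalIdeal Rq) Rq),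
      (∀ m ∈ P, ((χ m : 𝒮 0) : S) = ∏ i, x i ^ m i) ∧
      ∀ (m : Fin n →₀ ℕ) (hm : m ∈ P), e ⟨MvPowerSeries.monomial m 1, monomial_mem hm 1⟩ =
        algebraMap Rq (AdicCompletion (maximalIdeal Rq) Rq) (algebraMap (𝒮 0) Rq (χ m)) := by
  obtain ⟨hPfg, hrank, hdim, χ, hχ, hχ0, hχadd, hχm, hgen⟩ :=
    chartData_of_parameters 𝒮 hA 𝔔 hfix x a hxa hspan hn P hP Rq
  haveI : IsNoetherianRing (𝒮 0) := isNoetherianRing_gradeZero 𝒮 hA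
  haveI : IsNoetherianRing Rq :=
    IsLocalization.isNoetherianRing (𝔔.comap (algebraMap (𝒮 0) S)).primeCompl Rq inferInstance
  obtain ⟨e, he⟩ := exists_ringEquiv_monoidPowerSeries_adicCompletion_of_chartData
    ((algebraMap (𝒮 0) Rq).comp (algebraMap k (𝒮 0))) P hPfg (fun m => algebraMap (𝒮 0) Rq (χ m))
    (by rw [hχ0, map_one]) (fun m hm m' hm' => by rw [hχadd m hm m' hm', map_mul]) hχm hgen
    (by rw [hdim, hrank])
  exact ⟨χ, e, hχ, he⟩

end Summit.ResolutionOfSingularities.ResolutionOfSingularities.Theorems.FRationalResolution.FixedPointCompletionChart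

end
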